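import Mathlib
import Summits.ValiantsHypothesis.ValiantsHypothesis.Theses.ValuativeGCT
import Literature.NumberTheory.DiophantineGeometry.TensorWordModel

/-!
# The valuative truncation is multiplicative (`stub_truncMul`)

Write `T_U(Dg, t, χ)` for the valuative truncation of the crux `ValuativeGCT.ValuativeFlip` with free
degree `Dg`, threshold `t` and weight `χ`: the homogeneous polynomials of degree `Dg` on
`End ℂ^(m×m)` (variables `MatIdx m × MatIdx m`) that lie in the `t`-th power of the vanishing ideal
`P_U` of `L_U = {A : every row of A lies in U}`, are invariant under every substitution
`σ_M : X (i, j) ↦ ∑ l, M l j • X (i, l)` with `M` in the `End`-stabiliser of `det_m`, and are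
`B`-semi-invariants of weight `χ` for the upper triangular Borel acting by
`ρ_g : X (i, j) ↦ ∑ l, g⁻¹ i l • X (l, j)`.

Then `G₁ ∈ T_U(D₁, t₁, χ₁)` and `G₂ ∈ T_U(D₂, t₂, χ₂)` give `G₁ G₂ ∈ T_U(D₁ + D₂, t₁ + t₂, χ₁ + χ₂)`:
homogeneous degrees add (`MvPolynomial.IsHomogeneous.mul`); `P^{t₁} P^{t₂} = P^{t₁ + t₂}`
(`pow_add`, `Ideal.mul_mem_mul`); each `σ_M = MvPolynomial.aeval _` is a ring map, so
`σ_M (G₁ G₂) = G₁ G₂`; each `ρ_g = MvPolynomial.aeval _` is a ring map and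
`weightChar (χ₁ + χ₂) g = weightChar χ₁ g * weightChar χ₂ g` for upper triangular `g`
(`weightChar_add`).
-/

set_option linter.dupNamespace false

namespace Summit.ValiantsHypothesis.ValiantsHypothesis.Theorems.ValuativeFlip

noncomputable section

open scoped BigOperators Matrix
open Literature.NumberTheory.DiophantineGeometry Literature.Computability.AlgebraicComplexity

/-- **Multiplicativity of the valuative truncation.**  With `T_U(Dg, t, χ)` the four-fold
intersection (degree-`Dg` homogeneous component) ⊓ (`t`-th power of the vanishing ideal of
`L_U = {A : every row of A lies in U}`) ⊓ (invariants of every substitution `σ_M`, `M` in the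
`End`-stabiliser of `det_m`) ⊓ (`B`-semi-invariants of weight `χ`), membership is multiplicative:
`G₁ ∈ T_U(D₁, t₁, χ₁)`, `G₂ ∈ T_U(D₂, t₂, χ₂)` imply `G₁ * G₂ ∈ T_U(D₁ + D₂, t₁ + t₂, χ₁ + χ₂)`
(degrees, thresholds and weights add). -/
theorem stub_truncMul :
    ∀ (m : ℕ) (U : Submodule ℂ (MatIdx m → ℂ)) (D₁ D₂ t₁ t₂ : ℕ) (χ₁ χ₂ : Weight (MatIdx m))
      (G₁ G₂ : MvPolynomial (MatIdx m × MatIdx m) ℂ),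
      G₁ ∈ MvPolynomial.homogeneousSubmodule (MatIdx m × MatIdx m) ℂ D₁ ⊓
          ((MvPolynomial.vanishingIdeal ℂ
              {p : MatIdx m × MatIdx m → ℂ | ∀ j : MatIdx m, (fun i => p (j, i)) ∈ U}) ^ t₁).restrictScalars ℂ ⊓
          (⨅ (M : Matrix (MatIdx m) (MatIdx m) ℂ)
            (_ : linSubst (MatIdx m) ℂ M (detFormLex ℂ m) = detFormLex ℂ m),
            LinearMap.ker ((MvPolynomial.aeval fun p : MatIdx m × MatIdx m =>
                ∑ l : MatIdx m, M l p.2 •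
                  (MvPolynomial.X (p.1, l) : MvPolynomial (MatIdx m × MatIdx m) ℂ)).toLinearMap -
              (LinearMap.id : MvPolynomial (MatIdx m × MatIdx m) ℂ →ₗ[ℂ] MvPolynomial (MatIdx m × MatIdx m) ℂ))) ⊓
          (⨅ (g : Matrix.GeneralLinearGroup (MatIdx m) ℂ) (_ : IsUpperTriangular g),
            LinearMap.ker ((MvPolynomial.aeval fun p : MatIdx m × MatIdx m =>
                ∑ l : MatIdx m, ((g⁻¹ : Matrix.GeneralLinearGroup (MatIdx m) ℂ) :
                  Matrix (MatIdx m) (MatIdx m) ℂ) p.1 l •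
                    (MvPolynomial.X (l, p.2) : MvPolynomial (MatIdx m × MatIdx m) ℂ)).toLinearMap -
              weightChar χ₁ g •
                (LinearMap.id : MvPolynomial (MatIdx m × MatIdx m) ℂ →ₗ[ℂ] MvPolynomial (MatIdx m × MatIdx m) ℂ))) →
      G₂ ∈ MvPolynomial.homogeneousSubmodule (MatIdx m × MatIdx m) ℂ D₂ ⊓
          ((MvPolynomial.vanishingIdeal ℂ
              {p : MatIdx m × MatIdx m → ℂ | ∀ j : MatIdx m, (fun i => p (j, i)) ∈ U}) ^ t₂).restrictScalars ℂ ⊓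
          (⨅ (M : Matrix (MatIdx m) (MatIdx m) ℂ)
            (_ : linSubst (MatIdx m) ℂ M (detFormLex ℂ m) = detFormLex ℂ m),
            LinearMap.ker ((MvPolynomial.aeval fun p : MatIdx m × MatIdx m =>
                ∑ l : MatIdx m, M l p.2 •
                  (MvPolynomial.X (p.1, l) : MvPolynomial (MatIdx m × MatIdx m) ℂ)).toLinearMap -
              (LinearMap.id : MvPolynomial (MatIdx m × MatIdx m) ℂ →ₗ[ℂ] MvPolynomial (MatIdx m × MatIdx m) ℂ))) ⊓
          (⨅ (g : Matrix.GeneralLinearGroup (MatIdx m) ℂ) (_ : IsUpperTriangular g),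
            LinearMap.ker ((MvPolynomial.aeval fun p : MatIdx m × MatIdx m =>
                ∑ l : MatIdx m, ((g⁻¹ : Matrix.GeneralLinearGroup (MatIdx m) ℂ) :
                  Matrix (MatIdx m) (MatIdx m) ℂ) p.1 l •
                    (MvPolynomial.X (l, p.2) : MvPolynomial (MatIdx m × MatIdx m) ℂ)).toLinearMap -
              weightChar χ₂ g •
                (LinearMap.id : MvPolynomial (MatIdx m × MatIdx m) ℂ →ₗ[ℂ] MvPolynomial (MatIdx m × MatIdx m) ℂ))) →
      G₁ * G₂ ∈ MvPolynomial.homogeneousSubmodule (MatIdx m × MatIdx m) ℂ (D₁ + D₂) ⊓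
          ((MvPolynomial.vanishingIdeal ℂ
              {p : MatIdx m × MatIdx m → ℂ | ∀ j : MatIdx m, (fun i => p (j, i)) ∈ U}) ^ (t₁ + t₂)).restrictScalars ℂ ⊓
          (⨅ (M : Matrix (MatIdx m) (MatIdx m) ℂ)
            (_ : linSubst (MatIdx m) ℂ M (detFormLex ℂ m) = detFormLex ℂ m),
            LinearMap.ker ((MvPolynomial.aeval fun p : MatIdx m × MatIdx m =>
                ∑ l : MatIdx m, M l p.2 •
                  (MvPolynomial.X (p.1, l) : MvPolynomial (MatIdx m × MatIdx m) ℂ)).toLinearMap -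
              (LinearMap.id : MvPolynomial (MatIdx m × MatIdx m) ℂ →ₗ[ℂ] MvPolynomial (MatIdx m × MatIdx m) ℂ))) ⊓
          (⨅ (g : Matrix.GeneralLinearGroup (MatIdx m) ℂ) (_ : IsUpperTriangular g),
            LinearMap.ker ((MvPolynomial.aeval fun p : MatIdx m × MatIdx m =>
                ∑ l : MatIdx m, ((g⁻¹ : Matrix.GeneralLinearGroup (MatIdx m) ℂ) :
                  Matrix (MatIdx m) (MatIdx m) ℂ) p.1 l •
                    (MvPolynomial.X (l, p.2) : MvPolynomial (MatIdx m × MatIdx m) ℂ)).toLinearMap -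
              weightChar (χ₁ + χ₂) g •
                (LinearMap.id : MvPolynomial (MatIdx m × MatIdx m) ℂ →ₗ[ℂ] MvPolynomial (MatIdx m × MatIdx m) ℂ))) := by
  intro m U D₁ D₂ t₁ t₂ χ₁ χ₂ G₁ G₂ h₁ h₂
  simp only [Submodule.mem_inf, Submodule.mem_iInf, LinearMap.mem_ker, LinearMap.sub_apply,
    LinearMap.smul_apply, LinearMap.id_apply, AlgHom.toLinearMap_apply,
    Submodule.restrictScalars_mem, sub_eq_zero] at h₁ h₂ ⊢
  obtain ⟨⟨⟨h1h, h1p⟩, h1s⟩, h1b⟩ := h₁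
  obtain ⟨⟨⟨h2h, h2p⟩, h2s⟩, h2b⟩ := h₂
  refine ⟨⟨⟨?_, ?_⟩, fun M hM => ?_⟩, fun g hg => ?_⟩
  · -- homogeneous degrees add
    rw [MvPolynomial.mem_homogeneousSubmodule] at h1h h2h ⊢
    exact h1h.mul h2h
  · -- `P ^ t₁ * P ^ t₂ = P ^ (t₁ + t₂)`
    rw [pow_add]
    exact Ideal.mul_mem_mul h1p h2p
  · -- `σ_M` is a ring map
    rw [map_mul, h1s M hM, h2s M hM]
  · -- `ρ_g` is a ring map and weight characters are additive on the Borel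
    rw [map_mul, h1b g hg, h2b g hg, weightChar_add χ₁ χ₂ hg, smul_mul_smul_comm]

end

end Summit.ValiantsHypothesis.ValiantsHypothesis.Theorems.ValuativeFlip
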